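import Summits.PneNP.PneNP.Theses.KrwChromaticSteering
import HarnessLib

/-!
# No finite refutation of `StrongComposition` / `StandardFromStrong` (route KrwChromaticSteering)

Negative-side bookkeeping for the cruxes stmt-PneNP-18538 (C1 = `StrongComposition`) and
stmt-PneNP-18539 (C2 = `StandardFromStrong`): for EVERY size threshold `N`, each crux is equivalent
to its restriction to block sizes `N ≤ m·n` — below `N` the trivial "send your input" protocols
(`exists_solves_sendInput`: every `KW_f`, `f : {0,1}^m → {0,1}`, has a protocol of depth
`≤ m + ⌊log₂ m⌋ + 1`) cost at most `4N + 2 ≤ (c + 4N + 2)·(⌊log₂ (m n)⌋ + 1)` rounds, which the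
`∃ c` absorbs.  Consequence for refuters: no table of exact values at bounded block sizes (brute force /
SAT censuses such as kit jobs `j281476`, `j287298`, `j287544`, `j287909`, `j289454`) can refute C1 or
C2; an unconditional refutation must exhibit a saving `ω(log (m n))` along an infinite family — i.e.
refute weak KRW (Meir 2023, Conj. 2).  Stated negatively (`not_strongCompositionFrom_of_not`,
`not_standardFromStrongFrom_of_not`) and as equivalences.  Sorry-free; axioms standard.
[folklore; cite: KarchmerWigderson1990, §2 (trivial protocol)]
-/

set_option linter.dupNamespace false
set_option autoImplicit false

namespace Summit.PneNP.PneNP.Theorems.StrongComposition.Negative.NoFiniteRefutation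

open Literature.Computability.Complexity

universe u

/-! ### The "send your input" protocol for `KW_g` (depth `n + ⌊log₂ n⌋ + 1`) -/

section SendInput

variable {ι : Type u} [DecidableEq ι]

/-- The assignment `a` restricted to the listed coordinates (`false` elsewhere). -/
def restrictTo (l : List ι) (a : ι → Bool) : ι → Bool := fun j => if j ∈ l then a j else false

/-- Alice announces her bits at the listed coordinates, one round each, then the play continues in
`T w` where `w` records the announced bits. [folklore] -/
def aliceSend : List ι → ((ι → Bool) → KWTree ι) → KWTree ι
  | [], T => T fun _ => false
  | i :: l, T =>
      KWTree.alice (fun a => a i) (aliceSend l fun w => T (Function.update w i false))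
        (aliceSend l fun w => T (Function.update w i true))

omit [DecidableEq ι] in
/-- Announcing one more bit `a i` updates the restricted assignment. -/
private theorem update_restrictTo (l : List ι) (a : ι → Bool) (i : ι) [DecidableEq ι] :
    Function.update (restrictTo l a) i (a i) = restrictTo (i :: l) a := by
  funext j
  by_cases hj : j = i
  · subst hj; simp [restrictTo]
  · simp [restrictTo, hj]

/-- Run law of `aliceSend`. [folklore] -/
theorem run_aliceSend : ∀ (l : List ι) (T : (ι → Bool) → KWTree ι) (a b : ι → Bool),
    (aliceSend l T).run a b = (T (restrictTo l a)).run a b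
  | [], T, a, b => by
    have : restrictTo ([] : List ι) a = fun _ => false := by funext j; simp [restrictTo]
    simp [aliceSend, this]
  | i :: l, T, a, b => by
    simp only [aliceSend, KWTree.run_alice]
    cases hai : a i
    · simp only [Bool.false_eq_true, ↓reduceIte]
      rw [run_aliceSend l _ a b, ← update_restrictTo l a i, hai]
    · simp only [↓reduceIte]
      rw [run_aliceSend l _ a b, ← update_restrictTo l a i, hai]

/-- Depth law of `aliceSend`: `|l|` rounds plus the deepest continuation. [folklore] -/
theorem depth_aliceSend_le : ∀ (l : List ι) (T : (ι → Bool) → KWTree ι) (D : ℕ),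
    (∀ w, (T w).depth ≤ D) → (aliceSend l T).depth ≤ l.length + D
  | [], T, D, h => by simpa [aliceSend] using h _
  | i :: l, T, D, h => by
    have h0 := depth_aliceSend_le l (fun w => T (Function.update w i false)) D fun w => h _
    have h1 := depth_aliceSend_le l (fun w => T (Function.update w i true)) D fun w => h _
    simp only [aliceSend, KWTree.depth_alice, List.length_cons]
    omega

end SendInput

/-- The number of a coordinate where `u` and `v` differ (`0` if none). -/
noncomputable def firstDiff {n : ℕ} (u v : Fin n → Bool) : ℕ :=
  if h : ∃ i : Fin n, u i ≠ v i then ((Classical.choose h : Fin n) : ℕ) else 0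

/-- `ℕ → Fin n` with junk value `⟨0, _⟩` out of range (needs `1 ≤ n`). -/
def eltOf {n : ℕ} (hn : 1 ≤ n) (l : ℕ) : Fin n := if h : l < n then ⟨l, h⟩ else ⟨0, hn⟩

/-- Bob's stage once he knows Alice's input `u`: he names a differing coordinate in
`⌊log₂ n⌋ + 1` rounds. -/
noncomputable def bobStage {n : ℕ} (hn : 1 ≤ n) (u : Fin n → Bool) : KWTree (Fin n) :=
  KWTree.bobChoose (Nat.log 2 n + 1) (firstDiff u) fun l => KWTree.leaf (eltOf hn l)

/-- **The trivial `KW_g` protocol**: Alice sends her whole input (`n` rounds), Bob names a differing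
coordinate (`⌊log₂ n⌋ + 1` rounds): every `g : {0,1}ⁿ → {0,1}` has `D(KW_g) ≤ n + ⌊log₂ n⌋ + 1`.
[folklore; cite: KarchmerWigderson1990, §2 (trivial upper bound)] -/
theorem exists_solves_sendInput {n : ℕ} (hn : 1 ≤ n) (g : (Fin n → Bool) → Bool) :
    ∃ R : KWTree (Fin n), R.Solves g ∧ R.depth ≤ n + (Nat.log 2 n + 1) := by
  classical
  refine ⟨aliceSend (List.finRange n) (bobStage hn), ?_, ?_⟩
  · intro u v hu hv
    have hres : restrictTo (List.finRange n) u = u := by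
      funext j; simp [restrictTo, List.mem_finRange]
    rw [run_aliceSend, hres]
    have hne : ∃ i : Fin n, u i ≠ v i := by
      by_contra hcon
      push Not at hcon
      have huv : u = v := funext hcon
      rw [huv, hv] at hu
      exact Bool.false_ne_true hu
    have hfd : firstDiff u v = ((Classical.choose hne : Fin n) : ℕ) := by
      simp [firstDiff, dif_pos hne]
    have hlt : firstDiff u v < 2 ^ (Nat.log 2 n + 1) := by
      rw [hfd]
      exact lt_of_lt_of_le (Classical.choose hne).isLt (Nat.lt_pow_succ_log_self one_lt_two n).le
    simp only [bobStage]
    rw [KWTree.run_bobChoose _ _ _ u v hlt, KWTree.run_leaf, hfd]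
    have helt : eltOf hn ((Classical.choose hne : Fin n) : ℕ) = Classical.choose hne := by
      simp [eltOf]
    rw [helt]
    exact Classical.choose_spec hne
  · refine (depth_aliceSend_le _ _ (Nat.log 2 n + 1) fun w => ?_).trans ?_
    · exact KWTree.depth_bobChoose_le (Nat.log 2 n + 1) (firstDiff w)
        (fun l => KWTree.leaf (eltOf hn l)) 0 (fun j _ => by simp)
    · simp [List.length_finRange]

/-- A non-constant `f : {0,1}^m → {0,1}` forces `1 ≤ m`. -/
theorem one_le_of_nonconst {m : ℕ} {f : (Fin m → Bool) → Bool} (hf : ∃ a b, f a ≠ f b) : 1 ≤ m := by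
  rcases Nat.eq_zero_or_pos m with rfl | hm
  · obtain ⟨a, b, hab⟩ := hf
    exact absurd (congrArg f (Subsingleton.elim a b)) hab
  · exact hm


/-! ## The equivalences -/

/-- C1 restricted to block sizes `N ≤ m·n`. -/
def StrongCompositionFrom (N : ℕ) : Prop :=
  ∃ c : ℕ, ∀ m n : ℕ, N ≤ m * n → 1 ≤ n → ∀ f : (Fin m → Bool) → Bool, (∃ a b, f a ≠ f b) →
    ∃ g : (Fin n → Bool) → Bool, ∀ P : KWTree (Fin m × Fin n), P.SolvesStrong f g →
      ∃ Q : KWTree (Fin m), Q.Solves f ∧ Q.depth + n ≤ P.depth + c * (Nat.log 2 (m * n) + 1)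

/-- C2 restricted to block sizes `N ≤ m·n`. -/
def StandardFromStrongFrom (N : ℕ) : Prop :=
  ∃ c : ℕ, ∀ m n : ℕ, N ≤ m * n → 1 ≤ n → ∀ f : (Fin m → Bool) → Bool, (∃ a b, f a ≠ f b) →
    ∃ g₀ : (Fin n → Bool) → Bool, ∀ g : (Fin n → Bool) → Bool, ∀ P : KWTree (Fin m × Fin n),
      P.Solves (blockComp f g₀) → ∃ P' : KWTree (Fin m × Fin n),
        P'.SolvesStrong f g ∧ P'.depth ≤ P.depth + c * (Nat.log 2 (m * n) + 1)

/-- Below `N` the two trivial protocols together cost at most `4N + 2` rounds. -/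
theorem sendInput_budget_le {N m n : ℕ} (hN : m * n < N) (hm : 1 ≤ m) (hn : 1 ≤ n) :
    (m + (Nat.log 2 m + 1)) + (n + (Nat.log 2 n + 1)) + 1 ≤ 4 * N + 2 := by
  have h1 : m ≤ m * n := Nat.le_mul_of_pos_right m hn
  have h2 : n ≤ m * n := Nat.le_mul_of_pos_left n hm
  have h3 : Nat.log 2 m ≤ m := Nat.log_le_self 2 m
  have h4 : Nat.log 2 n ≤ n := Nat.log_le_self 2 n
  omega

/-- The enlarged constant dominates: `4N + 2 ≤ (c + (4N + 2))·(⌊log₂ (m n)⌋ + 1)`. -/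
theorem budget_le_const_mul (c N m n : ℕ) :
    4 * N + 2 ≤ (c + (4 * N + 2)) * (Nat.log 2 (m * n) + 1) := by
  calc 4 * N + 2 = (4 * N + 2) * 1 := (mul_one _).symm
    _ ≤ (c + (4 * N + 2)) * (Nat.log 2 (m * n) + 1) :=
        Nat.mul_le_mul (Nat.le_add_left _ _) (Nat.succ_le_succ (Nat.zero_le _))

/-- **C1 is equivalent to C1 above any size threshold** (constant `c ↦ c + 4N + 2`). -/
theorem strongComposition_iff_from (N : ℕ) :
    Summit.PneNP.PneNP.Theses.KrwChromaticSteering.StrongComposition ↔ StrongCompositionFrom N := by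
  constructor
  · rintro ⟨c, h⟩
    exact ⟨c, fun m n _ hn f hf => h m n hn f hf⟩
  · rintro ⟨c, h⟩
    refine ⟨c + (4 * N + 2), fun m n hn f hf => ?_⟩
    by_cases hmn : N ≤ m * n
    · obtain ⟨g, hg⟩ := h m n hmn hn f hf
      refine ⟨g, fun P hP => ?_⟩
      obtain ⟨Q, hQ, hQd⟩ := hg P hP
      refine ⟨Q, hQ, hQd.trans (Nat.add_le_add_left (Nat.mul_le_mul_right _ (Nat.le_add_right c _)) _)⟩
    · have hlt : m * n < N := Nat.lt_of_not_le hmn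
      have hm : 1 ≤ m := one_le_of_nonconst hf
      obtain ⟨Q, hQ, hQd⟩ := exists_solves_sendInput hm f
      refine ⟨fun _ => true, fun P _ => ⟨Q, hQ, ?_⟩⟩
      have hb := sendInput_budget_le hlt hm hn
      have hc := budget_le_const_mul c N m n
      omega

/-- **C2 is equivalent to C2 above any size threshold** (constant `c ↦ c + 4N + 2`; below `N` the
strong protocol is the obvious `compose g R Q` of the two trivial protocols, for ANY `g`, ignoring `P`). -/
theorem standardFromStrong_iff_from (N : ℕ) :
    Summit.PneNP.PneNP.Theses.KrwChromaticSteering.StandardFromStrong ↔ StandardFromStrongFrom N := by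
  constructor
  · rintro ⟨c, h⟩
    exact ⟨c, fun m n _ hn f hf => h m n hn f hf⟩
  · rintro ⟨c, h⟩
    refine ⟨c + (4 * N + 2), fun m n hn f hf => ?_⟩
    by_cases hmn : N ≤ m * n
    · obtain ⟨g₀, hg₀⟩ := h m n hmn hn f hf
      refine ⟨g₀, fun g P hP => ?_⟩
      obtain ⟨P', hP', hP'd⟩ := hg₀ g P hP
      exact ⟨P', hP', hP'd.trans (Nat.add_le_add_left (Nat.mul_le_mul_right _ (Nat.le_add_right c _)) _)⟩
    · have hlt : m * n < N := Nat.lt_of_not_le hmn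
      have hm : 1 ≤ m := one_le_of_nonconst hf
      obtain ⟨Q, hQ, hQd⟩ := exists_solves_sendInput hm f
      refine ⟨fun _ => true, fun g P _ => ?_⟩
      obtain ⟨R, hR, hRd⟩ := exists_solves_sendInput hn g
      refine ⟨KWTree.compose g R Q, KWTree.solvesStrong_compose hQ hR, ?_⟩
      rw [KWTree.depth_compose]
      have hb := sendInput_budget_le hlt hm hn
      have hc := budget_le_const_mul c N m n
      omega


/-- **Negative form (C1).**  A refutation of C1 refutes C1 above every size threshold: whatever is
computed at bounded sizes is irrelevant. -/
theorem not_strongCompositionFrom_of_not (N : ℕ)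
    (h : ¬ Summit.PneNP.PneNP.Theses.KrwChromaticSteering.StrongComposition) :
    ¬ StrongCompositionFrom N :=
  fun hN => h ((strongComposition_iff_from N).2 hN)

/-- **Negative form (C2).** -/
theorem not_standardFromStrongFrom_of_not (N : ℕ)
    (h : ¬ Summit.PneNP.PneNP.Theses.KrwChromaticSteering.StandardFromStrong) :
    ¬ StandardFromStrongFrom N :=
  fun hN => h ((standardFromStrong_iff_from N).2 hN)

end Summit.PneNP.PneNP.Theorems.StrongComposition.Negative.NoFiniteRefutation
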